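import Summits.BirchSwinnertonDyer.BirchSwinnertonDyer.Theorems.AlignedTransportAtTwoMainConjectureTransportAlignedAtTwoNegTwistSymbol
import Summits.BirchSwinnertonDyer.BirchSwinnertonDyer.Theorems.AlignedTransportAtTwoMainConjectureTransportAlignedAtTwoNegTwistTransform
import HarnessLib

/-!
# Route `AlignedTransportAtTwo`, crux C1 `MainConjectureTransportAlignedAtTwo` (stmt-BirchSwinnertonDyer-22296), line `birth` — NEGATIVE
# twists: the mod-`2` twist congruence `L_A' ≡ v·L_W·∏_{ℓ∣d}𝒫_ℓ (mod 2Λ)` for `A = E^{(d)}`, `d < 0`, WITH the period size of Birch's constant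
# `|d|·(Ω⁺_{f_A})² = c_A²·(Ω⁻_{f_W})²` — the `d < 0` twin of the cell `bsd-2adic` kernel congruence `exists_iwasawa_twist_congr_two_and_sq`,
# under ONE extra hypothesis: the period lattice of `f_W` is RHOMBIC (`IsRhombic f_W`; at curve level `Δ_W < 0`)

HONEST FRAMING (cell `bsd-f1-sign2`, lead seat `bsd-line-att-p1` g7). BSD is NOT proved; C1 is NOT closed. THEOREMS ONLY; nothing asserted;
`--supports stmt-BirchSwinnertonDyer-22296 --as helper`. Assembly of the rhombic shortcut: `…NegTwistSymbol.lean` (odd Birch lemma + extended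
rhombic congruence ⟹ Birch relation on PLUS symbols up to integers), `…NegTwistMeasure.lean` / `…NegTwistTransform.lean` (⟹
`L₂(f_A, α_A) = C(c)·(1+T)^{−f}·L₂(f_W, |d|, α_W, 𝟙) + 2c·ι(E)`), and the tree's depletion half `exists_iwasawa_padicLFunctionTame_one_congr_two_auto`
(`L₂(f_W, |d|, α_W, 𝟙) ≡ u·L₂(f_W, α_W)·∏𝒫_ℓ (mod 2)`, Matsuno 2000 Lemma 3.3 at `2`). No minus Mazur–Swinnerton-Dyer measure is used.

* §1 `exists_iwasawa_twist_congr_two_and_sq_of_neg` — for `E = W/ℚ` globally minimal, good ordinary at `2`, with `Λ_{f_W}` rhombic, `d < 0`,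
  `d ≡ 1 (mod 4)` square-free and prime to `N_E`, `A` a globally minimal model of `E^{(d)}`, newforms `f_W, f_A`, `S₀` the places over the primes
  of `d`: there are `L_W, L_A' ∈ Λ`, `c_A ∈ ℚˣ`, `v ∈ Λˣ` with `ι L_W = L₂(f_W, α_W)`, `ι L_A' = C(c_A)·L₂(f_A, α_A)`,
  `L_A' ≡ v·L_W·∏_{v∈S₀}𝒫_v (mod 2Λ)` AND `|d|·(Ω⁺_{f_A})² = c_A²·(Ω⁻_{f_W})²`.

The period clause is read in `…NegTwistKida.lean` against V. Pal's `Ω(A)·√|d| = c_∞·|Ω⁻(W)|` (PROVED in the tree) and the period units at `2`.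

References: [Matsuno2000] Thm. 3.1, Lemmas 3.2–3.3 (pp. 86–88); [MazurTateTeitelbaum1986Invent] §I.8, §I.13; [Shimura1971] Prop. 3.64;
[GreenbergVatsal2000] §1 (8)–(9); [Pal2012] Thm. 3.2.
-/

set_option autoImplicit false
set_option linter.dupNamespace false

noncomputable section

open scoped Classical MatrixGroups ModularForm NumberTheorySymbols

open CongruenceSubgroup Filter Topology NumberField IsDedekindDomain WeierstrassCurve PowerSeries
open Literature.NumberTheory.EllipticCurves Literature.NumberTheory.EllipticCurves.ModularForms
  Literature.NumberTheory.EllipticCurves.GreenbergVatsal2000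
open Summit.BirchSwinnertonDyer.Rank1Residual.F1Sign2
open Summit.BirchSwinnertonDyer.BirchSwinnertonDyer.Theorems.AlignedTransportAtTwoNegTwistSymbol
open Summit.BirchSwinnertonDyer.BirchSwinnertonDyer.Theorems.AlignedTransportAtTwoNegTwistMeasure
open Summit.BirchSwinnertonDyer.BirchSwinnertonDyer.Theorems.AlignedTransportAtTwoNegTwistTransform

namespace Summit.BirchSwinnertonDyer.BirchSwinnertonDyer.Theorems.AlignedTransportAtTwoNegTwistCongruence

section TwoAdic

variable (W : WeierstrassCurve ℚ) [W.IsElliptic] [W.IsGloballyMinimal] {d : ℤ} {A : WeierstrassCurve ℚ}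
  [A.IsElliptic] [A.IsGloballyMinimal]
  [NeZero (W.conductorNorm ℤ)] [NeZero (A.conductorNorm ℤ)]
  {fW : CuspForm (Gamma0 (W.conductorNorm ℤ)) 2} {fA : CuspForm (Gamma0 (A.conductorNorm ℤ)) 2}

omit [W.IsElliptic] [W.IsGloballyMinimal] [NeZero (W.conductorNorm ℤ)] [A.IsElliptic] [A.IsGloballyMinimal]
  [NeZero (A.conductorNorm ℤ)] in
/-- Distinct finite places of `ℚ` lie over distinct primes; private helper. [folklore] -/
private theorem natGenerator_injective_rat' :
    Function.Injective (Rat.HeightOneSpectrum.natGenerator (R := 𝓞 ℚ)) := fun _ _ h ↦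
  (Rat.HeightOneSpectrum.primesEquiv (R := 𝓞 ℚ)).injective (Subtype.ext h)

omit [W.IsElliptic] [W.IsGloballyMinimal] [NeZero (W.conductorNorm ℤ)] [A.IsElliptic] [A.IsGloballyMinimal]
  [NeZero (A.conductorNorm ℤ)] in
/-- `toZMod(2) = 0` in `ℤ/2`, so `C(2)·E ≡ 0 (mod 2)`; private helper. [folklore] -/
private theorem map_toZMod_C_two_mul (E : IwasawaAlgebra 2) :
    PowerSeries.map (PadicInt.toZMod (p := 2)) (PowerSeries.C (2 : ℤ_[2]) * E) = 0 := by
  rw [map_mul, PowerSeries.map_C, map_ofNat, show (2 : ZMod 2) = 0 from rfl, map_zero, zero_mul]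

/-- **The mod-`2` twist congruence at a good ordinary `2` for a NEGATIVE twist, WITH the period size of the constant** (`d < 0` twin of the
tree's `exists_iwasawa_twist_congr_two_and_sq`; Matsuno 2000, proof of Thm. 3.1 READ AT `p = 2` through the rhombic shortcut). For `E = W/ℚ`
globally minimal, good ordinary at `2`, whose newform `f_W` has RHOMBIC period lattice, `d < 0`, `d ≡ 1 (mod 4)` square-free and prime to `N_E`,
`A` a globally minimal model of `E^{(d)}`, newforms `f_W`, `f_A`, and `S₀` the set of places over the primes of `d`: there are
`L_W, L_A' ∈ Λ = ℤ₂⟦T⟧`, `c_A ∈ ℚˣ`, `v ∈ Λˣ` with `ι L_W = L₂(f_W, α_W)`, `ι L_A' = C(c_A)·L₂(f_A, α_A)`, `L_A' ≡ v·L_W·∏_{v∈S₀}𝒫_v (mod 2Λ)`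
AND `|d|·(Ω⁺_{f_A})² = c_A²·(Ω⁻_{f_W})²` (`c_A = c⁻¹` for the odd Birch constant `c`, `c²·|d|·(Ω⁺_{f_A})² = (Ω⁻_{f_W})²`). Ingredients: odd Birch
relation + extended rhombic congruence (`exists_int_ratPlusSymbol_twist_eq_sum_plus_add`), transform congruence
(`exists_padicLFunction_twist_eq_add_two_mul`), depletion half (`exists_iwasawa_padicLFunctionTame_one_congr_two_auto`), `α_A = χ_d(2)α_W`.
[cite: Matsuno2000, Lemmas 3.2–3.3 and proof of Theorem 3.1 (pp. 86–88)] [cite: MazurTateTeitelbaum1986Invent, §I.8, §I.13] [cite: Shimura1971, Prop. 3.64] -/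
theorem exists_iwasawa_twist_congr_two_and_sq_of_neg (hmod : exists_isNewformOf) (hd : d < 0) (hd4 : d % 4 = 1)
    (hsq : Squarefree d) (hcop : IsCoprime d (W.conductorNorm ℤ : ℤ)) {C : VariableChange ℚ}
    (hA : C • W.quadraticTwist (d : ℚ) = A) (hfW : IsNewformOf W fW) (hfA : IsNewformOf A fA)
    (hord : IsOrdinaryAt W 2) (hrh : IsRhombic fW) (S₀ : Finset (HeightOneSpectrum (𝓞 ℚ)))
    (hS₀ : S₀.image Rat.HeightOneSpectrum.natGenerator = d.natAbs.primeFactors) :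
    ∃ (LW LA' : IwasawaAlgebra 2) (cA : ℚ) (v : (IwasawaAlgebra 2)ˣ),
      iwasawaToPowerSeries 2 LW = padicLFunction fW (unitRoot W 2 : ℚ_[2]) ∧ cA ≠ 0 ∧
      iwasawaToPowerSeries 2 LA' = PowerSeries.C (cA : ℚ_[2]) * padicLFunction fA (unitRoot A 2 : ℚ_[2]) ∧
      PowerSeries.map (PadicInt.toZMod (p := 2)) LA' =
        PowerSeries.map (PadicInt.toZMod (p := 2)) ((v : IwasawaAlgebra 2) * LW * eulerFactorProduct W 2 S₀) ∧
      (d.natAbs : ℝ) * plusPeriod fA ^ 2 = (cA : ℝ) ^ 2 * minusPeriod fW ^ 2 := by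
  have hd0 : d ≠ 0 := hd.ne
  haveI : NeZero d.natAbs := ⟨Int.natAbs_ne_zero.mpr hd0⟩
  set m : ℕ := d.natAbs with hmdef
  have hsq' : Squarefree m := Int.squarefree_natAbs.mpr hsq
  have hm4 : m % 4 = 3 := by omega
  have hd2 : ¬ (2 : ℤ) ∣ d := by omega
  have hm2 : m.Coprime 2 := by
    rw [Nat.coprime_two_right, Nat.odd_iff]; omega
  have h2N : ¬ 2 ∣ W.conductorNorm ℤ := not_dvd_level_of_isNewformOf hfW hord.1
  have hmN : m.Coprime (W.conductorNorm ℤ) := by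
    have h := Int.isCoprime_iff_gcd_eq_one.mp hcop
    unfold Int.gcd at h
    simpa using h
  -- the Jacobi character `χ_d` mod `m = |d|`
  obtain ⟨χ, hχ⟩ := exists_mulChar_int_eq_jacobiSym m
  set χℚ : MulChar (ZMod m) ℚ := χ.ringHomComp (Int.castRingHom ℚ) with hχℚ
  have hodd : χ (-1) = -1 := mulChar_jacobi_apply_neg_one_of_three hχ hm4
  have hχ2 : χℚ (2 : ZMod m) ^ 2 = 1 := by
    have h := mulChar_jacobi_apply_natCast_sq hχ 2 (Nat.coprime_comm.mp hm2)
    rw [Nat.cast_ofNat] at h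
    rw [hχℚ, MulChar.ringHomComp_apply, ← map_pow, h, map_one]
  have hχv : ∀ b : ZMod m, IsUnit b → χℚ b ^ 2 = 1 := fun b hb ↦ by
    rw [hχℚ, MulChar.ringHomComp_apply, ← map_pow, mulChar_jacobi_apply_sq_of_isUnit hχ hb, map_one]
  -- odd Birch with the period constant, and the rhombic shortcut
  obtain ⟨c, hB, hper⟩ := exists_ratPlusSymbol_twist_eq_sum_odd_and_sq W hmod hd hd4 hsq hcop hA hfW hfA hχ
  have hxA : ∃ x : ℚ, ratPlusSymbol fA x ≠ 0 := exists_ratPlusSymbol_ne_zero hfA.1 hfA.coeffField_eq_bot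
  have hc0 : c ≠ 0 := by
    rintro rfl
    obtain ⟨x, hx⟩ := hxA
    exact hx (by rw [hB x, zero_mul])
  have hBk : ∀ x : ℚ, Nat.Coprime x.den (W.conductorNorm ℤ) →
      ∃ k : ℤ, ratPlusSymbol fA x = c * (∑ b : ZMod m, χℚ b * ratPlusSymbol fW (x + (b.val : ℚ) / m) + k) :=
    fun x hx ↦ exists_int_ratPlusSymbol_twist_eq_sum_plus_add fW fA hfW.1 hfW.coeffField_eq_bot hrh hmN χ hodd hB x hx
  -- unit roots: `α_A = χ(2)·α_W`
  obtain ⟨hαeq, hαu, -⟩ := unitRoot_coe_spec (W := W) hord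
  have hap : cuspCoeff fW 2 = ((W.frobeniusTrace 2 : ℤ) : ℂ) := cuspCoeff_eq_frobeniusTrace_of_isNewformOf_holds hfW hord.1
  obtain ⟨hordA, hαA⟩ := isOrdinaryAt_twist_and_unitRoot_eq W 2 hmod hd4 hsq hcop hA hord hd2
  have hαA' : (unitRoot A 2 : ℚ_[2]) = ((χℚ (2 : ZMod m) : ℚ) : ℚ_[2]) * (unitRoot W 2 : ℚ_[2]) := by
    have h2 : χℚ (2 : ZMod m) = (J((2 : ℤ) | m) : ℚ) := by
      rw [hχℚ, MulChar.ringHomComp_apply, ← Nat.cast_ofNat, mulChar_jacobi_apply_natCast hχ 2, eq_intCast, Nat.cast_ofNat]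
    rw [hαA, h2]
    push_cast
    rfl
  have hTg : ∀ k : ℕ, Tendsto (padicLRiemannSum fA (((χℚ (2 : ZMod m) : ℚ) : ℚ_[2]) * (unitRoot W 2 : ℚ_[2])) k) atTop
      (𝓝 (padicLCoeff fA (((χℚ (2 : ZMod m) : ℚ) : ℚ_[2]) * (unitRoot W 2 : ℚ_[2])) k)) := by
    intro k
    obtain ⟨hαAeq, hαAu, -⟩ := unitRoot_coe_spec (W := A) hordA
    rw [← hαA']
    exact tendsto_padicLRiemannSum_holds (f := fA) (p := 2) hfA.1 hfA.coeffField_eq_bot (not_dvd_level_of_isNewformOf hfA hordA.1)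
      (cuspCoeff_eq_frobeniusTrace_of_isNewformOf_holds hfA hordA.1) hαAeq hαAu k
  -- the transform congruence `L₂(f_A, α_A) = C(c)·B·L₂(f_W, m, α_W, 𝟙) + C(2c)·ι(E)`
  obtain ⟨E, hE⟩ := exists_padicLFunction_twist_eq_add_two_mul fW fA hfW.1 hfW.coeffField_eq_bot h2N hm2 hmN hap hαeq hαu
    χℚ hχ2 hχv hBk hTg
  rw [← hαA'] at hE
  -- the depletion half
  have hS2 : ∀ v ∈ S₀, Rat.HeightOneSpectrum.natGenerator v ≠ 2 := by
    intro v hv h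
    have hmem : Rat.HeightOneSpectrum.natGenerator v ∈ d.natAbs.primeFactors := hS₀ ▸ Finset.mem_image_of_mem _ hv
    rw [h] at hmem
    exact hd2 (Int.natCast_dvd.mpr (Nat.dvd_of_mem_primeFactors hmem))
  have hgood : ∀ v ∈ S₀, W.HasGoodReductionAt v := by
    intro v hv
    refine hasGoodReductionAt_of_not_dvd_conductorNorm W v fun hvN ↦ ?_
    have hmem : Rat.HeightOneSpectrum.natGenerator v ∈ d.natAbs.primeFactors := hS₀ ▸ Finset.mem_image_of_mem _ hv
    have hℓ : (Rat.HeightOneSpectrum.natGenerator v).Prime := Nat.prime_of_mem_primeFactors hmem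
    have hℓd : (Rat.HeightOneSpectrum.natGenerator v : ℤ) ∣ d := Int.natCast_dvd.mpr (Nat.dvd_of_mem_primeFactors hmem)
    have hu := Int.isUnit_iff_natAbs_eq.mp (hcop.isUnit_of_dvd' hℓd (Int.natCast_dvd_natCast.mpr hvN))
    rw [Int.natAbs_natCast] at hu
    exact hℓ.one_lt.ne' hu
  have hm : m = ∏ v ∈ S₀, Rat.HeightOneSpectrum.natGenerator v := by
    have h := Nat.prod_primeFactors_of_squarefree hsq'
    rw [hmdef] at h ⊢
    rw [← hS₀, Finset.prod_image fun v _ w _ h ↦ natGenerator_injective_rat' h] at h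
    exact h.symm
  obtain ⟨LW, G₁, u, hLW, hG₁, hG₁c⟩ := exists_iwasawa_padicLFunctionTame_one_congr_two_auto hord hfW S₀ hS2 hgood hm
  -- the unit `(1+T)^{−f_m}` of `Λ` and the integral element `L_A' = B·G₁ + 2E`
  set B : IwasawaAlgebra 2 := PowerSeries.binomialSeries ℤ_[2] (-frobeniusExponent 2 (m : ℤ_[2])) with hBdef
  have hBu : IsUnit B :=
    isUnit_iff_exists_inv.mpr ⟨PowerSeries.binomialSeries ℤ_[2] (frobeniusExponent 2 (m : ℤ_[2])), by
      rw [hBdef, ← PowerSeries.binomialSeries_add, neg_add_cancel, PowerSeries.binomialSeries_zero]⟩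
  have hcQ : (c : ℚ_[2]) ≠ 0 := by exact_mod_cast hc0
  have hperiod : (m : ℝ) * plusPeriod fA ^ 2 = ((c⁻¹ : ℚ) : ℝ) ^ 2 * minusPeriod fW ^ 2 := by
    have hcR : (c : ℝ) ≠ 0 := by exact_mod_cast hc0
    rw [← hper hxA, hmdef]
    push_cast
    field_simp
  refine ⟨LW, B * G₁ + PowerSeries.C (2 : ℤ_[2]) * E, c⁻¹, hBu.unit * u, hLW, inv_ne_zero hc0, ?_, ?_, hperiod⟩
  · -- `ι(B·G₁ + 2E) = c⁻¹·L₂(f_A, α_A)`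
    have hι2 : iwasawaToPowerSeries 2 (PowerSeries.C (2 : ℤ_[2])) = PowerSeries.C (2 : ℚ_[2]) := by
      show PowerSeries.map (algebraMap ℤ_[2] ℚ_[2]) (PowerSeries.C (2 : ℤ_[2])) = _
      rw [PowerSeries.map_C, map_ofNat]
    rw [map_add, map_mul, map_mul, hG₁, hBdef, BurungaleSkinner2023.iwasawaToPowerSeries_binomialSeries, hι2, hE, Rat.cast_inv]
    have h2c : PowerSeries.C (2 * (c : ℚ_[2])) = PowerSeries.C (2 : ℚ_[2]) * PowerSeries.C (c : ℚ_[2]) := by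
      rw [← map_mul]
    rw [h2c, mul_add, ← mul_assoc, ← mul_assoc, ← map_mul, inv_mul_cancel₀ hcQ, map_one, one_mul]
    rw [show PowerSeries.C (c : ℚ_[2])⁻¹ * (PowerSeries.C (2 : ℚ_[2]) * PowerSeries.C (c : ℚ_[2]) * iwasawaToPowerSeries 2 E) =
      (PowerSeries.C (c : ℚ_[2])⁻¹ * PowerSeries.C (c : ℚ_[2])) * (PowerSeries.C (2 : ℚ_[2]) * iwasawaToPowerSeries 2 E) by ring,
      ← map_mul, inv_mul_cancel₀ hcQ, map_one, one_mul]
  · -- `B·G₁ + 2E ≡ (B u)·L_W·∏𝒫 (mod 2)`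
    rw [map_add, map_toZMod_C_two_mul, add_zero, map_mul, hG₁c, ← map_mul, Units.val_mul, IsUnit.unit_spec]
    congr 1
    ring

end TwoAdic

end Summit.BirchSwinnertonDyer.BirchSwinnertonDyer.Theorems.AlignedTransportAtTwoNegTwistCongruence

end
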